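import Summits.HodgeConjecture.HodgeConjecture.Theorems.F0P6aModuliDatumLayers
import HarnessLib

/-!
# `F0P6aModuliDatum` — ★ RE-HOME of `Lines/F0_P6a_ModuliDatum.lean`, PART 3 of 3 (size-lint split; cut at a declaration boundary).

Imports (bare lines; provenance here): `Theorems.F0P6aModuliDatumLayers` = ★ the previous part of the same `Lines` workfile (size-lint split ×3) · `HarnessLib`.
See PART 1 `Theorems/F0P6aModuliDatumLetters.lean` for the full re-home header and the original module docstring (verbatim there). Namespaces and sections KEPT
(re-opened below exactly as they stand at the cut, with their `open`∕`variable` lines replayed); code bytes = the workfile՚s, docstrings included; options preamble repeated from PART 1.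
HC_CM is proved only modulo the 7 printed citations (2 remaining: hLiu418 = stmt-HodgeConjecture-24832, h413 = stmt-HodgeConjecture-24833) until rung 0 closes; a re-home is count-neutral. -/

namespace Summit.HodgeConjecture.HodgeConjecture.Cruxes.HLiu418.F0P6aModuliDatum
set_option linter.dupNamespace false  -- `Summit.HodgeConjecture.HodgeConjecture.…` BY DESIGN (D-0017), as in `Lines/d6_cm_curve.lean`
open CategoryTheory NumberField IsDedekindDomain MulAction
open scoped Matrix
open Literature.NumberTheory.GaloisRepresentations
open Literature.NumberTheory.Automorphic Literature.NumberTheory.Automorphic.UnitaryGroup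
open Literature.AlgebraicGeometry.ShimuraVarieties.UnitaryCanonicalModel
open Literature.NumberTheory.Automorphic.Liu2021.AppendixC
open Literature.AlgebraicGeometry.Motives (AlgPoints IntegralModel frobeniusOver SchemeOver)
open Literature.NumberTheory.DiophantineGeometry (geomResidueField specialFibreFunctor)
open Literature.AlgebraicGeometry.RelativeSpec (ActionOver)
open Literature.NumberTheory.EllipticCurves (genericFibre)
open Summit.HodgeConjecture.HodgeConjecture.Cruxes.HLiu418.F0P6aPointwiseFrobenius (FrobeniusDichotomy)
open Summit.HodgeConjecture.HodgeConjecture.Cruxes.HLiu418.F0D9opRoad2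
  (PointwiseFrobeniusDatumAt RecordModuliPointwiseCoreCofinal)


/-! #### §4.4′ (ED. 3) THE CUT OF `stub_MH` — three registered stubs over the DEFS companion and the PROVED glue `mh_of_datum`

The letters are the `Prop`s of `Lines/F0_P6a_ModuliDatumDefs.lean` BY NAME (`RecordModuliDatumCofinal` = MH՚s telescope ⟶ `hdisj ∧ Nonempty (ModuliDatum …)`;
`RecordHeartFrobenius` = `∀ ctx ∀ 𝔇, 𝔇.HeartFrob`; `RecordHeartDictionary` = `∀ ctx ∀ 𝔇 σ hσ Fr₀, (ii) → (iii) → 𝔇.HeartFrob → Nonempty (PointDictionary …)`).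
Orientation of record (`Cruxes/HLiu418/HEART-FROB.md` v4 §K; LEAD M-16 (2); K-TEST «t₁» ★ p845445): `𝒢_y = A_y[(c•w)^∞]`, `A₀` multiplicative at the frame
place `w`, REP F-linear covariant, right-`t₁(w)`-translate = index-`q` sublattice at `w` = quotient by a `c•w`-side line, `k = 0` — all of it wording of
`ModuliDatum`՚s layer (ii); no TYPE below depends on it. -/

section ED3

open Summit.HodgeConjecture.HodgeConjecture.Cruxes.HLiu418.F0P6aModuliDatumDefs
  (ModuliDatum RecordModuliDatumCofinal RecordHeartFrobenius RecordHeartDictionary)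

/-- **REGISTERED STUB `stub_RGD` — `RecordModuliDatumCofinal`** (ED. 3; XL; owner F0-P6a; letter RGD = REP + GEN + HECKE + TWIST (+ INJ + FROB₀ + BANAL at
layer (ii)) + the disjoint-sheets clause `hdisj`).  In print: the RSZ ∕ Kottwitz PEL moduli problem is a fine moduli SCHEME over `𝒪_{Fᵢ}[1∕N]` for neat level
(REP), its generic fibre is `M⋆_{Kc} ⊗_F Fᵢ` compatibly with the Galois action (GEN; ONE reflex-type field `Fᵢ` for all components), prime-to-`p` Hecke
translates are isogeny quotients (HECKE), and the special images of distinct sheets are disjoint for `w` unramified in `Fᵢ` (`hdisj`; a theorem for the witness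
`𝓜 := restrictScalarsOfIntermediate hinj 𝓜ᵢ` by ★ `eq_one_of_geomReductionMap_thickeningLift_eq`, A-p03 (g28) p845310 — `S_M ⊇` primes ramified in `Fᵢ`).
WHY IT MIGHT FAIL as typed: representability needs `N ≥ 3`, `w ∤ N` (absorbed by `Kc`, `S_M`); the layer-(ii) identification must be the honest F-linear
covariant REP (M-16 (1)).  ED. 5 (R): PAID BY IMPORT modulo the RGD SPINE՚s registered stubs `stub_PEL` ∕ `stub_DATUM` (`F0P6aRGDAssembly.rgd_of_parts`; was ONE honest `sorry` through ED. 4); ED. 7 (M-53 (6)): PAID BY IMPORT of the two PAY-DOWN LINES through the spine՚s parametric head — `rgd_of_inputs pel_of_line datum_of_line` — modulo their registered stubs {`stub_DUALS`, `stub_SPREAD`} ∪ {`stub_LINES`, `stub_DOWN`, `stub_FROB`}}; ED. 7 v2 (M-59 (3)): the D-side reads the D-LINE ED. 2 parametric head `datum_of_inputs` with `stub_LINES` PAID BY NAME by the L1 closer leaf `StubLINES.stub_LINES_of_organs` ⇒ debt {`stub_DUALS`, `stub_SPREAD`} ∪ {`stub_DOWN`, `stub_FROB`}; ED. 8 (M-55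 (c), SOCKET PLAN (A)): the P-side reads `pel_of_inputs (spread_of_parts ‹GSPREAD› stub_INJ0 ‹GEN leaf head›) stub_DUALS` ⇒ debt {`stub_DUALS`} ∪ {`stub_GSPREAD`, `stub_GEN`} ∪ {`stub_DOWN`, `stub_FROB`}; ED. 9: GSPREAD ↦ `F0P6aStubGSPREAD.gspread_of_line`, DUALS ↦ ★ `MumfordDual.dualPairOfAmpleRigidified` ⇒ debt {`stub_GEN`} ∪ {`stub_DOWN`, `stub_FROB`}; ED. 10 (S1): DOWN ↦ `F0P6aStubDOWN.stub_DOWN_of_organs`, FROB ↦ `F0P6aStubFROB.stubFROB_of_parts`, both leaves sorry-free, GEN paid through the X-leaf ⇒ expected debt ∅ — the tie՚s `--axioms` line decides). (print: RapoportSmithlingZhang2020Diagonal, §4.1 Thm. 4.1 p. 17; (4.3), (4.23)) (print: Kottwitz1992, §5 pp. 389–391, §8 p. 400)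
(print: Liu2021, Rem. C.2 p. 108, Lemma C.16–C.18 pp. 114–115, proof of Prop. C.20 p. 118) (print: HarrisTaylorAMS2001, §III.4 pp. 108–110) (print: Lan2013, 1.4.1.11) (print: SGA1, Exp. V §1) -/
theorem stub_RGD : RecordModuliDatumCofinal :=
  -- ED. 10 ((S1), M-81 (2)): the DOWN ∕ FROB slots read the L2 ∕ L3 closer-leaf heads `F0P6aStubDOWN.stub_DOWN_of_organs` ∕ `F0P6aStubFROB.stubFROB_of_parts` BY NAME — both sorry-free at this edition.
  -- ED. 9 (M-68 NEXT): the GSPREAD slot reads the (A2) closer leaf head and the DUALS slot reads ★ `MumfordDual.dualPairOfAmpleRigidified` — both sorry-free, by name.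
  -- ED. 8 (M-55 (c) ∕ SOCKET PLAN (A)): BODY BY IMPORT = the RGD SPINE՚s PARAMETRIC HEAD over the P-LINE՚s PARAMETRIC HEAD — itself over the L4 CLOSER LEAF՚s
  -- PARAMETRIC HEAD fed BY NAME (GSPREAD slot, the PAID `stub_INJ0`, the GEN closer leaf head) + the DUALS socket — and the D-LINE՚s PARAMETRIC HEAD (L1 closer leaf + two sockets).
  Summit.HodgeConjecture.HodgeConjecture.Cruxes.HLiu418.F0P6aRGDAssembly.rgd_of_inputs
    (Summit.HodgeConjecture.HodgeConjecture.Cruxes.HLiu418.F0P6aPELInputs.pel_of_inputs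
      (Summit.HodgeConjecture.HodgeConjecture.Cruxes.HLiu418.F0P6aPELSpread.spread_of_parts
        Summit.HodgeConjecture.HodgeConjecture.Cruxes.HLiu418.F0P6aStubGSPREAD.gspread_of_line
        Summit.HodgeConjecture.HodgeConjecture.Cruxes.HLiu418.F0P6aPELSpread.stub_INJ0
        Summit.HodgeConjecture.HodgeConjecture.Cruxes.HLiu418.F0P6aStubGEN.elaws_of_line)
      Literature.AlgebraicGeometry.AbelianSchemes.MumfordDual.dualPairOfAmpleRigidified)
    (Summit.HodgeConjecture.HodgeConjecture.Cruxes.HLiu418.F0P6aDatumOfInputs.datum_of_inputs_star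
      @Summit.HodgeConjecture.HodgeConjecture.Cruxes.HLiu418.F0P6aDatumOfInputs.L1Fold.stub_LINES_of_organs
      @Summit.HodgeConjecture.HodgeConjecture.Cruxes.HLiu418.F0P6aStubDOWN.stub_DOWN_of_organs
      @Summit.HodgeConjecture.HodgeConjecture.Cruxes.HLiu418.F0P6aStubFROB.stubFROB_of_parts)

/-- **REGISTERED STUB `stub_HFROB` — `RecordHeartFrobenius`** (ED. 3; rank 2; owner F0-P6a; letter HFROB = HEART-FROB′, tuple-free, FORM-II, ordinary and
supersingular in ONE clause): for every moduli datum `𝔇` at MH՚s binders, every arithmetic Frobenius `σ`, every generic point `y` and every line `L` of `y`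
specialising to the Frobenius kernel, `red₀ (𝔇.quotΩ y L) = red₀ (σ • y)`.  In print: the canonical subgroup of the ordinary one-dimensional block lifts
`ker F`, and the quotient by it (⊕ its dual position) IS the relative-Frobenius twist — on CM points by Shimura–Taniyama ∕ the record՚s reciprocity (K-TEST
★ `recip_cmPoint_mem_doubleCoset_heckeElementAt`), on all ordinary points by Serre–Tate (named sub-lemma CENTRAL-OR), at supersingular points for every line
([Liu2021] pp. 137–138 via [SP 0CCZ]).  Hands (director req225 (D)): σ1 = block computation via DUAL-POSITION kernels (ST-0′ + ST-1 + FROB₀ + (H4-R2)), σ2 =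
via SERRE-TENSOR recognition of `A^{(q)}` (ST-2 ∕ ST-4 ∕ FROB-PIC ∕ (DF)).  WHY IT MIGHT FAIL as typed: over layer (i) ALONE it is false for a perverse reading
datum (D418) — it is the statement for the datum WITH its layer-(ii) identification.  ED. 6 (M-33): CLOSED-DERIVED BY IMPORT of the Σ-LINE `F0P6aStubHFROBSigma2.heartFrob_of_twistIdeal_ne_bot`
(σ2 route; the σ1 DUAL-POSITION route stays capital) over the Defs ED. 3 field `twistIdeal_ne_bot` — was ONE honest `sorry` through ED. 5. (print: Liu2021, Prop. D.8 (3) p. 135, pp. 137–138)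
(print: Carayol1986Compositio, §10.3 Prop. p. 211) (print: Wedhorn2000CongruenceRelation, main theorem (Introduction)) (print: SerreTate1968, §1 Lemma 2) -/
theorem stub_HFROB : RecordHeartFrobenius := by
  -- ED. 6 (M-33): BODY BY IMPORT = the Σ-LINE head over the Defs ED. 3 field `twistIdeal_ne_bot` (ref1 (g3) docking rehearsal 63858204).
  intro F
  intros
  rename_i 𝔇
  exact F0P6aStubHFROBSigma2.heartFrob_of_twistIdeal_ne_bot 𝔇 𝔇.twistIdeal_ne_bot

set_option maxHeartbeats 400000 in
set_option synthInstance.maxHeartbeats 400000 in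
open Summit.HodgeConjecture.HodgeConjecture.Cruxes.HLiu418.F0P6aModuliDatumDefs (actOf red₀Of) in
open Summit.HodgeConjecture.HodgeConjecture.Cruxes.HLiu418.F0P6cDictConstructors
  (heart_of_carriers eq_kerF_or_isEtale_of_carriers quot_kerF_eq_of_lines nonempty_line_of_hecke) in
/-- **`stub_HEART` — `RecordHeartDictionary`, PAID (ED. 4; was the REGISTERED STUB of ED. 3; L; owner F0-P6a with F0-P6c: formal at ED. 4 from P6c՚s `heart_of_constructors` over
`Lines/F0_P6c_DictConstructors.lean`): for every moduli datum `𝔇`, arithmetic Frobenius `σ` and `Fr₀` reading `σ` on every sheet ((ii)) and `θ`-equivariant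
((iii)), HEART-FROB′ yields `Nonempty (PointDictionary … Kc P₀ Fr₀ red₀)` — (c1) `hecke` and (c2) are `𝔇`՚s fields; (c3a) `quot x̄ (kerF x̄) = Fr₀ x̄` from
`HeartFrob` + (c2) + (ii) on the image of `red₀` (★ `quot_kerF_of_heartFrob'`) and TRANSPORT ∕ SHEET-COVER off it; (c3b)(c3c)(b)(b4′) from the P6b ∕ P6d organs
through `𝔇`՚s layers.  WHY IT MIGHT FAIL as typed: `Fr₀` is ANY map with (ii)(iii) — (ii) at the sheet `e` pins it on the image of `red₀`, (iii) + SHEET-COVER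
everywhere.  PAID at ED. 4 (F0P6c-plan (g3) closer, sorry-free, `--axioms` TRIO): ONE TERM over P6c `heart_of_carriers` (`Lines/F0_P6c_DictConstructors.lean` ED. 3 §4) with the three in-datum derivations `hcover` := ★ SHEET-COVER `IntegralModel.exists_aut_geomReductionMap_thickeningLift_eq_of_isSmoothProper` BY NAME, `hHFimg` := P6c §5 (5b) `quot_kerF_eq_of_lines` ∘ (5a) `eq_kerF_or_isEtale_of_carriers` from `𝔇.HeartFrob` read on the sheet `e`, `hne` := P6c (6) `nonempty_line_of_hecke` from `𝔇.hecke`; every other argument a field of `𝔇` ∕ of `𝔇.block₀` VERBATIM. (print: Liu2021, Prop. D.8 p. 135, pp. 136–138) (print: HarrisTaylorAMS2001, §III.4 pp. 108–110) (print: Carayol1986Compositio, §10.3 Prop. p. 211) -/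
theorem stub_HEART : RecordHeartDictionary := by
  intro F _ _ _ _ ι₁ Jstar K₀ S hU7ₛ hJ hJu Fi _ _ _ _ Kc G _ _ 𝓜 w hw h𝓨 θ hθ e _hunit _hKc _hdisj 𝔇 σ hσ Fr₀ hFrRed hFrAct hHF
  -- ROW 1 DERIVED BY NAME (★ SHEET-COVER p845161 `IntegralModel.exists_aut_geomReductionMap_thickeningLift_eq_of_isSmoothProper`; `actOf`∕`red₀Of` unfold definitionally):
  have hcover : ∀ x : AlgPoints (𝓜.localise w).reductionAt (geomResidueField w),
      ∃ (c : Fi ≃ₐ[F] Fi) (y : AlgPoints (S.M.obj Kc) (AlgebraicClosure (w.adicCompletion F))),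
        x = actOf S Kc 𝓜 w θ c (red₀Of S Kc 𝓜 w h𝓨 e y) :=
    fun x => IntegralModel.exists_aut_geomReductionMap_thickeningLift_eq_of_isSmoothProper (S.M.obj Kc) (𝓜.localise w) h𝓨 θ hθ e x
  -- ROW 2′ DERIVED (P6c ED. 3 (6) `nonempty_line_of_hecke` from `𝔇.hecke` + the ★ record tower; LEAD ruling (b′) 20:50:18Z ∕ M-19):
  have hne : ∀ y : AlgPoints (S.M.obj Kc) (AlgebraicClosure (w.adicCompletion F)),
      (∀ H : 𝔇.Sub (red₀Of S Kc 𝓜 w h𝓨 e y), ¬ 𝔇.IsEtale H) → Nonempty (𝔇.Line y) :=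
    fun y _ => nonempty_line_of_hecke F ι₁ Jstar K₀ S hU7ₛ hJ hJu w hw Kc 𝔇.Line 𝔇.quotΩ 𝔇.translΩ 𝔇.hecke y
  -- instance plumbing from the datum: Prop-classes by `haveI`, the GrpObj DATA by `letI` (transparent), NOT tactic `haveI`
  haveI : Fact 𝔇.pChar.Prime := ⟨𝔇.hpChar.1⟩
  haveI : CharP (geomResidueField w) 𝔇.pChar := 𝔇.charP₀
  haveI : ExpChar (geomResidueField w) 𝔇.pChar := ExpChar.prime 𝔇.hpChar.1
  obtain ⟨G₀, grp₀, comm₀, aff₀, fin₀, β₀, hβ₀, ι₀G, hι₀G, hkerG₀, hβ₀G, U₀, grpU₀, affU₀, jU₀, hU₀, NU₀, θU₀, hFFU₀, hrkG₀, hrkF₀,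
    hpts₀, hsimple₀, subEquiv, kerF_spec, isEtale_spec, isogW₀, isogW₀_hom, isogW₀_ker, quot_quot₀, canonicalLine₀⟩ := 𝔇.block₀
  letI : ∀ x, GrpObj (G₀ x) := grp₀
  letI : ∀ x, IsCommMonObj (G₀ x) := comm₀
  letI : ∀ x, AlgebraicGeometry.IsAffine (G₀ x).left := aff₀
  letI : ∀ x, AlgebraicGeometry.IsFinite (G₀ x).hom := fin₀
  letI : ∀ x, GrpObj (U₀ x) := grpU₀
  letI : ∀ x, AlgebraicGeometry.IsAffine (U₀ x).left := affU₀
  -- `hHFimg` DERIVED (P6c ED. 3 §5): HEART-FROB′ on the sheet `e` + a line through `kerF` (canonical ∕ any by (5a))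
  have hHFimg : ∀ y : AlgPoints (S.M.obj Kc) (AlgebraicClosure (w.adicCompletion F)),
      𝔇.quot (red₀Of S Kc 𝓜 w h𝓨 e y) (𝔇.kerF (red₀Of S Kc 𝓜 w h𝓨 e y)) = Fr₀ (red₀Of S Kc 𝓜 w h𝓨 e y) :=
    quot_kerF_eq_of_lines Fr₀ (red₀Of S Kc 𝓜 w h𝓨 e) 𝔇.Line 𝔇.Sub 𝔇.kerF (fun H => 𝔇.IsEtale H) 𝔇.quotΩ 𝔇.quot 𝔇.sp 𝔇.red_quotΩ
      (eq_kerF_or_isEtale_of_carriers 𝔇.pChar 𝔇.fDeg G₀ β₀ hβ₀ U₀ jU₀ hU₀ NU₀ θU₀ hrkF₀ hpts₀ hsimple₀ 𝔇.Sub subEquiv 𝔇.kerF kerF_spec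
        (fun H => 𝔇.IsEtale H) isEtale_spec)
      canonicalLine₀ hne (fun y L h => (hHF σ hσ y L h).trans (hFrRed e y).symm)
  exact ⟨heart_of_carriers F ι₁ Jstar K₀ S hU7ₛ hJ hJu w hw Kc _ Fr₀ (red₀Of S Kc 𝓜 w h𝓨 e) 𝔇.pChar 𝔇.fDeg G₀ β₀ hβ₀ U₀ jU₀ hU₀ NU₀ θU₀
    hFFU₀ hrkG₀ hrkF₀ hpts₀ hsimple₀ 𝔇.Line 𝔇.Sub subEquiv 𝔇.kerF kerF_spec (fun H => 𝔇.IsEtale H) isEtale_spec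
    𝔇.quotΩ 𝔇.translΩ 𝔇.quot 𝔇.transl 𝔇.sp isogW₀ isogW₀_hom isogW₀_ker quot_quot₀ (actOf S Kc 𝓜 w θ) 𝔇.smap 𝔇.smap_kerF 𝔇.quot_smap
    hFrAct hcover hHFimg 𝔇.red_quotΩ 𝔇.red_translΩ canonicalLine₀ 𝔇.hecke⟩

set_option maxHeartbeats 400000 in
/-- **GLUE `mh_of_datum` — MH from RGD, HFROB, HEART, PROVED** (ED. 3): unpack RGD՚s telescope to `hdisj ∧ Nonempty (ModuliDatum …)` at `(w, h𝓨, θ, e)`,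
take an arithmetic Frobenius `σ` (★ `exists_isAbsArithFrob_holds`), the sheet-wise `θ`-equivariant Frobenius shadow `Fr₀` of ★
`IntegralModel.exists_sheetwise_frobeniusShadow (S.M.obj Kc) (𝓜.localise w) θ hθ hσ e hdisj` (A-p01 (g23) p845200: (i) = MH՚s `FrobeniusSheet` conjunct on the
nose, (ii) reading on every sheet, (iii) `θ`-equivariance), and feed (ii), (iii) and `HFROB … 𝔇` to HEART; MH՚s guards `hunit` ∕ `hKc` ∕ `hdisj` are passed to BOTH letters (cand v2; F0P5a-ref1 (s3)(b): the letters
claim exactly what MH consumes and nothing at bad `w`).  (print: SerreTate1968, §1 Lemma 2) -/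
theorem mh_of_datum (hRGD : RecordModuliDatumCofinal) (hHF : RecordHeartFrobenius) (hHEART : RecordHeartDictionary) :
    RecordModuliHeartCofinal := by
  intro F _ _ _ _ ι₁ Jstar K₀ S hU7ₛ hJ hJu K
  obtain ⟨Fi, _fFi, _aFi, _fdFi, _gFi, Kc, hKcK, hn, G, _gG, _fG, φ, hφ, hφker, 𝓜, _qc, _qs, _lfp, _fl, _sep, S_M, hfin, hrest⟩ :=
    hRGD F ι₁ Jstar K₀ S hU7ₛ hJ hJu K
  refine ⟨Fi, _fFi, _aFi, _fdFi, _gFi, Kc, hKcK, hn, G, _gG, _fG, φ, hφ, hφker, 𝓜, _qc, _qs, _lfp, _fl, _sep, S_M, hfin, ?_⟩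
  intro w hwS hw hunit hK
  obtain ⟨hKc, hall⟩ := hrest w hwS hw hunit hK
  refine ⟨hKc, ?_⟩
  intro h𝓨 θ hθ e
  obtain ⟨hdisj, ⟨𝔇⟩⟩ := hall h𝓨 θ hθ e
  haveI : AlgebraicGeometry.IsProper (𝓜.localise w).total.hom := h𝓨.2
  haveI : AlgebraicGeometry.SmoothOfRelativeDimension 1 (𝓜.localise w).total.hom := h𝓨.1
  haveI : AlgebraicGeometry.Smooth (𝓜.localise w).total.hom := AlgebraicGeometry.SmoothOfRelativeDimension.smooth 1 _
  obtain ⟨σ, hσ⟩ : ∃ σ : Field.absoluteGaloisGroup (w.adicCompletion F), IsAbsArithFrob σ := exists_isAbsArithFrob_holds _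
  obtain ⟨Fr₀, hi, hii, hiii⟩ :=
    Literature.AlgebraicGeometry.Motives.IntegralModel.exists_sheetwise_frobeniusShadow (S.M.obj Kc) (𝓜.localise w) θ hθ hσ e hdisj
  exact ⟨Fr₀, hi, hHEART F ι₁ Jstar K₀ S hU7ₛ hJ hJu Fi Kc G 𝓜 w hw h𝓨 θ hθ e hunit hKc hdisj 𝔇 σ hσ Fr₀ hii hiii
    (hHF F ι₁ Jstar K₀ S hU7ₛ hJ hJu Fi Kc G 𝓜 w hw h𝓨 θ hθ e hunit hKc hdisj 𝔇)⟩

end ED3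

/-! #### §4.4 The ED. 2 stub (PAID at ED. 3) and the body of `stub_UP` -/

/-- **REGISTERED STUB `stub_MH` — `RecordModuliHeartCofinal` — PAID at ED. 3** (was the ED. 2 `sorry`; XL; owner F0-P6a): BODY
`mh_of_datum stub_RGD stub_HFROB stub_HEART` (§4.4′) — REP ∕ GEN ∕ HECKE ∕ TWIST (+ layer (ii)) in `stub_RGD`, HEART-FROB′ in `stub_HFROB`, the dictionary in
`stub_HEART`, the Frobenius sheet ★ by name inside `mh_of_datum`.  Statement bytes of ED. 2 unchanged. (print: RapoportSmithlingZhang2020Diagonal, §4.1 Thm. 4.1 p. 17)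
(print: Kottwitz1992, §5 pp. 389–391, §8 p. 400) (print: Liu2021, Rem. C.2, Lemma C.18 p. 115, proof of Prop. C.20 p. 118, Prop. D.8 p. 135) (print: HarrisTaylorAMS2001, §III.4) -/
theorem stub_MH : RecordModuliHeartCofinal :=
  mh_of_datum stub_RGD stub_HFROB stub_HEART


/-- **REGISTERED STUB `stub_UP` — `RecordModuliPointwiseCoreUpstairsCofinal`** (ED. 1; XL; owner F0-P6a).  The moduli core one Galois
layer up: representability of the RSZ ∕ Kottwitz PEL problem over `𝒪_{Fᵢ}[1∕N]` (REP), the identification of its generic fibre with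
`M⋆_{Kc} ⊗_F Fᵢ` (GEN), the Galois and level actions with their stable affine cover (LEV), smooth-proper by spreading out (SPREAD ★), and the
Eichler–Shimura dictionary on CM tuples over `κ̄(w)` modulo the decomposition group (HEART + DICT + FROB-SHEET).  ED. 2: BODY `up_of_layers stub_MH`
— the GEO layer ★ by name (§4.3), the moduli heart the ONE stub `stub_MH` (§4.2–§4.4); statement bytes of ED. 1 unchanged.  (print: RapoportSmithlingZhang2020Diagonal, §4.1 Thm. 4.1 p. 17) (print: Kottwitz1992, §5
pp. 389–391, §8) (print: Liu2021, Prop. D.8 p. 135, proof of Cor. D.9 p. 139) (print: Carayol1986Compositio, §10.3, Prop. p. 211)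
(print: Wedhorn2000CongruenceRelation, main theorem (Introduction)) -/
theorem stub_UP : RecordModuliPointwiseCoreUpstairsCofinal :=
  up_of_layers stub_MH

/-- **REGISTERED STUB `stub_GALQ` — `RecordGaloisQuotientDescent` — PAID at ED. 1′** (was the ED. 1 `sorry`; M–L).  The tame Galois
quotient `𝒮c := 𝓨 ∕ Γ` with the descended level action `ρ`, its stable affine cover, the generic reading `ρ (φ k) = T_{k⁻¹}` and the
`Γ`-INVARIANT quotient map `πq` with generic fibre `π`: ONE application of the ★ organ
`Literature.AlgebraicGeometry.Motives.IntegralModel.exists_tameQuotient_descAction_inv` (`Motives/IntegralModelTameQuotientDescendedAction.lean`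
ED. 2 — hand GALQ ∕ GALQ-INV, **B-p18 (g34)**: ★ p844772 `RelativeSpec/GluedQuotientDescendedAction` (`ActionOver.descAction`), ★ p844839 +
★ p844888 (the organ, with the `Γ`-invariance conjunct = ★ `gluedMk` invariance); documentary twin ★ p844907
`Theorems/F0P6aStubGALQ.lean` `galq_holds_v2` = THIS statement verbatim with THIS proof, not importable next to the LEAD module by the
`RecordCurveSec42Datum` ∕ `D6CmCurveBody` twin clash, F0P6-ref1 o-6 — hence the organ-level paste, LEAD F0P6-plan M-4d R1′ ∕ M-6 (A)).
`M⋆_{Kc}` is separated over `F` because it is projective (record (F1), ★ `IsProjectiveOver.isProper`).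
(print: SGA1, Exp. V Prop. 1.9, Cor. 1.5) (print: KatzMazur1985, A7.1) (print: MumfordAV1970, §7 Thm. p. 66) -/
theorem stub_GALQ : RecordGaloisQuotientDescent := by
  intro F _ _ _ _ ι₁ Jstar K₀ S hU7ₛ _hJ _hJu K w Kc _hKcK hn G _ _ φ _hφ _hφker _hcard Y π Γ _ _ hcardΓ τ hτπ hτT 𝓨 h𝓨 θ hcovθ hθ
  haveI : AlgebraicGeometry.IsSeparated (S.M.obj Kc).hom := by
    haveI := (S.projective Kc).isProper
    infer_instance
  obtain ⟨𝒮c, h𝒮c, ρ, hcov, πq, hinv, -, hsq, hgen⟩ :=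
    Literature.AlgebraicGeometry.Motives.IntegralModel.exists_tameQuotient_descAction_inv 𝓨 h𝓨 θ hcovθ hcardΓ τ hθ π hτπ
  exact ⟨𝒮c, h𝒮c, ρ, hcov, fun k => hgen (φ k) _ (hτT k), πq, hinv, hsq⟩

/-- **HEAD `pwcore_holds` — the LEAD՚s MOD-PWCORE `F0D9opRoad2.RecordModuliPointwiseCoreCofinal` BY NAME** (ED. 1): from the two registered
stubs through the kernel-checked glue `pwcore_of_up_galq`; the parent line՚s ED. 8+ body of `stub_PWcore`. [folklore] -/
theorem pwcore_holds : RecordModuliPointwiseCoreCofinal :=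
  pwcore_of_up_galq stub_UP stub_GALQ

end Summit.HodgeConjecture.HodgeConjecture.Cruxes.HLiu418.F0P6aModuliDatum
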